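import Summits.CriticalPhenomena.CardyFormulaZ2.Theorems.CardyBoundaryCoulombGasBoundaryDefectGaussianRStubTransportPathsPart5

/-!
# Stub `stub_transportPaths` of line `rainbow-monomials-in-excursion-kernels` — Part 7:
# re-basing straight edges and the periodic enumeration of the corners
# (crux `CardyBoundaryCoulombGas.BoundaryDefectGaussianR`, stmt-CriticalPhenomena-14132)

Two bookkeeping tools for the polygon structure of a rectilinear Jordan frontier:

* `tp_seg_rebase`, `tp_seg_rebase_pow` — a strictly monotone straight parametrisation
  `γ t = γ a + ‖γ t - γ a‖ d` of `[a, b]` re-based at any `s ∈ [a, b]`: forward along `d`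
  (strictly increasing distance) on `[s, b]`, backward along `-d = d · i²` (strictly decreasing
  distance) on `[a, s]` — the germ data consumed by the uniqueness lemmas of Part 5;
* `tp_periodic_enum` — a finite set `C₀ ⊆ [0, 1)` with at least two elements (the corner
  parameters) is enumerated increasingly and periodically by `c : ℤ → ℝ`, strictly monotone,
  `c (z + M) = c z + 1` (`M = #C₀ ≥ 2`), with `{c z} = {t : fract t ∈ C₀}`.
All [folklore].
-/

noncomputable section

open Set Filter Metric Topology

namespace Summit.CriticalPhenomena.CardyFormulaZ2.Cruxes.BoundaryDefectGaussianR.RainbowMonomialsInExcursionKernels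

/-! ### Re-basing a straight monotone edge -/

/-- **Re-basing a straight edge.** If `γ t = γ a + ‖γ t - γ a‖ d` on `[a, b]` with `‖d‖ = 1`
and `t ↦ ‖γ t - γ a‖` strictly increasing, then from any `s ∈ [a, b]` the curve runs forward
along `d` on `[s, b]` with strictly increasing distance to `γ s`, and on `[a, s]` it is
`γ s + ‖γ t - γ s‖ (-d)` with strictly decreasing distance. [folklore] -/
theorem tp_seg_rebase {γ : ℝ → ℂ} {a b : ℝ} {d : ℂ} (hd : ‖d‖ = 1)
    (h : ∀ t ∈ Icc a b, γ t = γ a + ((‖γ t - γ a‖ : ℝ) : ℂ) * d)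
    (hmono : StrictMonoOn (fun t => ‖γ t - γ a‖) (Icc a b)) {s : ℝ} (hs : s ∈ Icc a b) :
    (∀ t ∈ Icc s b, γ t = γ s + ((‖γ t - γ s‖ : ℝ) : ℂ) * d) ∧
      StrictMonoOn (fun t => ‖γ t - γ s‖) (Icc s b) ∧
      (∀ t ∈ Icc a s, γ t = γ s + ((‖γ t - γ s‖ : ℝ) : ℂ) * -d) ∧
      StrictAntiOn (fun t => ‖γ t - γ s‖) (Icc a s) := by
  set f : ℝ → ℝ := fun t => ‖γ t - γ a‖ with hf
  have hdiff : ∀ t ∈ Icc a b, γ t - γ s = (((f t : ℝ) : ℂ) - ((f s : ℝ) : ℂ)) * d := by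
    intro t ht
    have e1 : γ t = γ a + ((f t : ℝ) : ℂ) * d := h t ht
    have e2 : γ s = γ a + ((f s : ℝ) : ℂ) * d := h s hs
    rw [e1, e2]
    ring
  have hnorm : ∀ t ∈ Icc a b, ‖γ t - γ s‖ = |f t - f s| := by
    intro t ht
    rw [hdiff t ht, ← Complex.ofReal_sub, norm_mul, hd, mul_one, Complex.norm_real,
      Real.norm_eq_abs]
  refine ⟨fun t ht => ?_, fun t ht t' ht' htt' => ?_, fun t ht => ?_, fun t ht t' ht' htt' => ?_⟩
  · have htI : t ∈ Icc a b := ⟨hs.1.trans ht.1, ht.2⟩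
    rw [hnorm t htI, abs_of_nonneg (sub_nonneg.2 (hmono.monotoneOn hs htI ht.1))]
    push_cast
    linear_combination hdiff t htI
  · have htI : t ∈ Icc a b := ⟨hs.1.trans ht.1, ht.2⟩
    have ht'I : t' ∈ Icc a b := ⟨hs.1.trans ht'.1, ht'.2⟩
    simp only
    rw [hnorm t htI, hnorm t' ht'I, abs_of_nonneg (sub_nonneg.2 (hmono.monotoneOn hs htI ht.1)),
      abs_of_nonneg (sub_nonneg.2 (hmono.monotoneOn hs ht'I ht'.1))]
    linarith [hmono htI ht'I htt']
  · have htI : t ∈ Icc a b := ⟨ht.1, ht.2.trans hs.2⟩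
    rw [hnorm t htI, abs_of_nonpos (sub_nonpos.2 (hmono.monotoneOn htI hs ht.2))]
    push_cast
    linear_combination hdiff t htI
  · have htI : t ∈ Icc a b := ⟨ht.1, ht.2.trans hs.2⟩
    have ht'I : t' ∈ Icc a b := ⟨ht'.1, ht'.2.trans hs.2⟩
    simp only
    rw [hnorm t htI, hnorm t' ht'I, abs_of_nonpos (sub_nonpos.2 (hmono.monotoneOn htI hs ht.2)),
      abs_of_nonpos (sub_nonpos.2 (hmono.monotoneOn ht'I hs ht'.2))]
    linarith [hmono htI ht'I htt']

/-- **Re-basing a straight edge (axis directions).** The same with `d = i^e`: forward along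
`i^e` on `[s, b]`, backward along `i^(e+2)` on `[a, s]`. [folklore] -/
theorem tp_seg_rebase_pow {γ : ℝ → ℂ} {a b : ℝ} {e : ℕ}
    (h : ∀ t ∈ Icc a b, γ t = γ a + ((‖γ t - γ a‖ : ℝ) : ℂ) * Complex.I ^ e)
    (hmono : StrictMonoOn (fun t => ‖γ t - γ a‖) (Icc a b)) {s : ℝ} (hs : s ∈ Icc a b) :
    (∀ t ∈ Icc s b, γ t = γ s + ((‖γ t - γ s‖ : ℝ) : ℂ) * Complex.I ^ e) ∧
      StrictMonoOn (fun t => ‖γ t - γ s‖) (Icc s b) ∧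
      (∀ t ∈ Icc a s, γ t = γ s + ((‖γ t - γ s‖ : ℝ) : ℂ) * Complex.I ^ (e + 2)) ∧
      StrictAntiOn (fun t => ‖γ t - γ s‖) (Icc a s) := by
  obtain ⟨h1, h2, h3, h4⟩ :=
    tp_seg_rebase (by rw [norm_pow, Complex.norm_I, one_pow]) h hmono hs
  refine ⟨h1, h2, fun t ht => ?_, h4⟩
  have e3 := h3 t ht
  generalize ‖γ t - γ s‖ = n at e3 ⊢
  rw [e3, pow_add, Complex.I_sq]
  ring

/-! ### Periodic enumeration of a finite subset of `[0, 1)` -/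

/-- **Periodic increasing enumeration.** A finite set `C₀ ⊆ [0, 1)` with at least two elements is
enumerated by a strictly increasing `c : ℤ → ℝ` with `c (z + M) = c z + 1` (`M = #C₀`), whose
values are exactly the reals with fractional part in `C₀`. [folklore] -/
theorem tp_periodic_enum (C₀ : Finset ℝ) (hC : ∀ t ∈ C₀, t ∈ Ico (0 : ℝ) 1)
    (hcard : 2 ≤ C₀.card) :
    ∃ (M : ℕ) (c : ℤ → ℝ), 2 ≤ M ∧ StrictMono c ∧ (∀ z, c (z + M) = c z + 1) ∧
      (∀ z, Int.fract (c z) ∈ C₀) ∧ (∀ t : ℝ, Int.fract t ∈ C₀ → ∃ z, c z = t) := by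
  classical
  set M := C₀.card with hM
  have hM0 : (0 : ℤ) < M := by
    have : 0 < M := by omega
    exact_mod_cast this
  set e := C₀.orderEmbOfFin rfl with he
  have hemem : ∀ i, e i ∈ C₀ := fun i => C₀.orderEmbOfFin_mem rfl i
  have he01 : ∀ i, e i ∈ Ico (0 : ℝ) 1 := fun i => hC _ (hemem i)
  have hidx : ∀ z : ℤ, (z % M).toNat < M := by
    intro z
    have h1 : 0 ≤ z % M := Int.emod_nonneg z hM0.ne'
    have h2 : z % M < M := Int.emod_lt_of_pos z hM0
    omega
  set c : ℤ → ℝ := fun z => e ⟨(z % M).toNat, hidx z⟩ + ((z / M : ℤ) : ℝ) with hc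
  refine ⟨M, c, hcard, ?_, ?_, ?_, ?_⟩
  · -- strictly increasing
    refine strictMono_int_of_lt_succ fun z => ?_
    have h1 : 0 ≤ z % M := Int.emod_nonneg z hM0.ne'
    have h2 : z % M < M := Int.emod_lt_of_pos z hM0
    have hdec := Int.emod_add_mul_ediv z M
    set i := (z % M).toNat with hi
    have hzi : (i : ℤ) = z % M := by rw [hi]; exact Int.toNat_of_nonneg h1
    by_cases hlast : i + 1 < M
    · have key : (z + 1) / M = z / M ∧ (z + 1) % M = (i : ℤ) + 1 := by
        rw [Int.ediv_emod_unique hM0]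
        refine ⟨by linarith, by omega, by omega⟩
      have hfin : (⟨((z + 1) % M).toNat, hidx (z + 1)⟩ : Fin M) = ⟨i + 1, hlast⟩ :=
        Fin.ext (by simp only; rw [key.2]; omega)
      have hlt : e ⟨i, by omega⟩ < e ⟨i + 1, hlast⟩ := e.strictMono (Fin.mk_lt_mk.2 (by omega))
      change e ⟨(z % M).toNat, hidx z⟩ + ((z / M : ℤ) : ℝ) <
        e ⟨((z + 1) % M).toNat, hidx (z + 1)⟩ + (((z + 1) / M : ℤ) : ℝ)
      rw [hfin, key.1]
      have hfin0 : (⟨(z % M).toNat, hidx z⟩ : Fin M) = ⟨i, by omega⟩ := Fin.ext (by simp [hi])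
      rw [hfin0]
      linarith
    · have hiM : (i : ℤ) + 1 = M := by omega
      have key : (z + 1) / M = z / M + 1 ∧ (z + 1) % M = 0 := by
        rw [Int.ediv_emod_unique hM0]
        refine ⟨by linarith, le_rfl, hM0⟩
      have hfin : (⟨((z + 1) % M).toNat, hidx (z + 1)⟩ : Fin M) = ⟨0, by omega⟩ :=
        Fin.ext (by simp only; rw [key.2]; rfl)
      change e ⟨(z % M).toNat, hidx z⟩ + ((z / M : ℤ) : ℝ) <
        e ⟨((z + 1) % M).toNat, hidx (z + 1)⟩ + (((z + 1) / M : ℤ) : ℝ)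
      rw [hfin, key.1]
      push_cast
      linarith [(he01 ⟨(z % M).toNat, hidx z⟩).2, (he01 ⟨0, by omega⟩).1]
  · -- periodicity
    intro z
    have key1 : (z + M) / M = z / M + 1 := by
      have := Int.add_mul_ediv_right z 1 hM0.ne'
      rwa [one_mul] at this
    have key2 : (z + M) % M = z % M := Int.add_emod_right z M
    have hfin : (⟨((z + M) % M).toNat, hidx (z + M)⟩ : Fin M) = ⟨(z % M).toNat, hidx z⟩ :=
      Fin.ext (by simp only; rw [key2])
    change e ⟨((z + M) % M).toNat, hidx (z + M)⟩ + (((z + M) / M : ℤ) : ℝ) =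
      e ⟨(z % M).toNat, hidx z⟩ + ((z / M : ℤ) : ℝ) + 1
    rw [hfin, key1]
    push_cast
    ring
  · -- values have fractional part in `C₀`
    intro z
    change Int.fract (e ⟨(z % M).toNat, hidx z⟩ + ((z / M : ℤ) : ℝ)) ∈ C₀
    rw [Int.fract_add_intCast, Int.fract_eq_self.2 ⟨(he01 _).1, (he01 _).2⟩]
    exact hemem _
  · -- every real with fractional part in `C₀` is a value
    intro t ht
    have hrange : Int.fract t ∈ Set.range e := by
      rw [Finset.range_orderEmbOfFin]; exact ht
    obtain ⟨i, hi⟩ := hrange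
    refine ⟨M * ⌊t⌋ + (i : ℕ), ?_⟩
    have key : (M * ⌊t⌋ + ((i : ℕ) : ℤ)) / M = ⌊t⌋ ∧ (M * ⌊t⌋ + ((i : ℕ) : ℤ)) % M = ((i : ℕ) : ℤ) := by
      rw [Int.ediv_emod_unique hM0]
      refine ⟨by ring, by positivity, by exact_mod_cast i.2⟩
    have hfin : (⟨((M * ⌊t⌋ + ((i : ℕ) : ℤ)) % M).toNat, hidx _⟩ : Fin M) = i :=
      Fin.ext (by simp only; rw [key.2]; rfl)
    change e ⟨((M * ⌊t⌋ + ((i : ℕ) : ℤ)) % M).toNat, hidx _⟩ +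
      (((M * ⌊t⌋ + ((i : ℕ) : ℤ)) / M : ℤ) : ℝ) = t
    rw [hfin, key.1, hi]
    exact Int.fract_add_floor t

/-- **Registered sub-goal `s7_periodicEnum` of stub `stub_transportPaths`** (periodic increasing
enumeration of the corner parameters, one-line form of `tp_periodic_enum`). [folklore] -/
theorem s7_periodicEnum : ∀ (C₀ : Finset ℝ), (∀ t ∈ C₀, t ∈ Set.Ico (0 : ℝ) 1) → 2 ≤ C₀.card → ∃ (M : ℕ) (c : ℤ → ℝ), 2 ≤ M ∧ StrictMono c ∧ (∀ z, c (z + M) = c z + 1) ∧ (∀ z, Int.fract (c z) ∈ C₀) ∧ (∀ t : ℝ, Int.fract t ∈ C₀ → ∃ z, c z = t) :=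
  fun C₀ hC hcard => tp_periodic_enum C₀ hC hcard

end Summit.CriticalPhenomena.CardyFormulaZ2.Cruxes.BoundaryDefectGaussianR.RainbowMonomialsInExcursionKernels

end
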